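import Literature.NumberTheory.Automorphic.UnitaryInfinityType
import Literature.NumberTheory.Automorphic.InfiniteIdelePolar
import HarnessLib

/-!
# Unitary idele class characters with prescribed pull-back and prescribed ∞-type

Topic `NumberTheory/Automorphic`; namespace `Literature.NumberTheory.Automorphic.IdeleClassGroup`.
`K` a number field, `C_K = IdeleClassGroup K`, `[·] : K_∞ˣ → C_K` (`infUnitsToClass`), `T ≤ K_∞ˣ`
the norm-one torus (`InfiniteIdelePolar.lean`).

**`exists_ideleClassChar_of_isProperMap`.** Let `f : A →* C_K` be a continuous PROPER homomorphism
of topological groups, `χA : A →* S¹` a continuous character killing `ker f`, and `e : (v ∣ ∞) → ℤ`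
an ∞-type COMPATIBLE with `χA` on `f(A) ∩ [K_∞ˣ]` (`f a = [u] ⇒ χA a = ∏_v (u_v/‖u_v‖)^{e_v}`);
suppose every infinite idele class is an `f(A)`-class times a norm-one class
(`hpolar : [K_∞ˣ] ≤ f(A) ⊔ [T]`). Then there is a continuous unitary character `ψ : C_K →ₜ* S¹`
with `ψ ∘ f = χA` and ∞-type `e`. The primed form `exists_ideleClassChar_of_isProperMap'` replaces
`hpolar` by `hpos : [posRealUnits] ≤ f(A)` (`IdeleClassGroup.hpolar_of_posRealUnits_le`).

Proof: `χA` factors through `f(A)` (`Literature.GroupTheory.MonoidHom.exists_range_factor`) and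
glues with the ∞-type character to a character of `B = f(A) ⊔ [K_∞ˣ]`
(`exists_char_sup_infUnits_of_compatible`); `B = f(A) ⊔ [T]` by `hpolar`, which is closed with the
glued character continuous because `f` is proper and `T` compact
(`continuous_char_range_sup_torus_iff`); a continuous unitary character of a subgroup containing
`[K_∞ˣ]` extends to `C_K` (`exists_ideleClassChar_of_compatible`,
`IdeleClassCharacterExtension.lean`). The typical use: `A = C_{K₀}` for a subfield `K₀`, `f` the
base change `C_{K₀} → C_K` (proper: the tree's `isProperMap_classBaseChange`,
`IdeleClassBaseChangeProper.lean`), `χA` an idele class character of `K₀` — a unitary Hecke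
character of `K` with prescribed restriction to `C_{K₀}` and prescribed ∞-type exists as soon as the
two prescriptions are compatible (A. Weil, *Basic Number Theory*, Ch. VII §3 / Ch. XIII;
[WeilBNT1967]). Everything is proved.

## Provenance

Reproduced for the tree under the LEAN-IN-TREE rule (2026-08-18) from the pub-hodgecm cell's
package file `HodgeCM/PerL34/N15Existence.lean` (130 lines; DAG-node prover #10 lineage, seat pv10,
gate run 22), re-based on the tree's `IdeleClassGroup K` (`UnitaryHeckeCharacter K` ↦
`IdeleClassGroup K →ₜ* Circle`, `NumberField.exists_unitaryHeckeCharacter_of_isProperMap` ↦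
`IdeleClassGroup.exists_ideleClassChar_of_isProperMap`), otherwise verbatim with added docstrings.
-/

set_option autoImplicit false

noncomputable section

open NumberField

namespace Literature.NumberTheory.Automorphic.IdeleClassGroup

open InfiniteAdeleRing

variable (K : Type) [Field K] [NumberField K]

/-- **Unitary idele class characters with prescribed pull-back along a proper `f : A →* C_K` and
prescribed ∞-type**, polar hypothesis in the form `[K_∞ˣ] ≤ f(A) ⊔ [T]`. See the module docstring.
[cite: WeilBNT1967, Ch. VII §3] -/
theorem exists_ideleClassChar_of_isProperMap {A : Type*} [Group A] [TopologicalSpace A]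
    (f : A →* IdeleClassGroup K) (hf : IsProperMap f)
    (χA : A →* Circle) (hχA : Continuous χA) (hker : ∀ a, f a = 1 → χA a = 1)
    (e : InfinitePlace K → ℤ)
    (hcompat : ∀ (a : A) (u : (InfiniteAdeleRing K)ˣ),
      f a = infUnitsToClass K u → χA a = infinityTypeChar K e u)
    (hpolar : (infUnitsToClass K).range ≤ f.range ⊔ (torusToClass K).range) :
    ∃ ψ : IdeleClassGroup K →ₜ* Circle,
      HasInfinityType K ψ e ∧ ∀ a : A, ψ (f a) = χA a := by
  classical
  -- Step 1: `χA` factors through `f(A)`.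
  obtain ⟨χ₁, hχ₁⟩ := Literature.GroupTheory.MonoidHom.exists_range_factor f χA hker
  -- Step 2: compatibility on `f(A) ∩ [K_∞ˣ]`.
  have hcompat' : ∀ (u : (InfiniteAdeleRing K)ˣ) (hu : infUnitsToClass K u ∈ f.range),
      χ₁ ⟨infUnitsToClass K u, hu⟩ = infinityTypeChar K e u := by
    intro u hu
    obtain ⟨a, ha⟩ := hu
    have hx : (⟨infUnitsToClass K u, ⟨a, ha⟩⟩ : f.range) = ⟨f a, ⟨a, rfl⟩⟩ := Subtype.ext ha.symm
    rw [hx, hχ₁ a]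
    exact hcompat a u ha
  -- Step 3: `B = f(A) ⊔ [K_∞ˣ] = f(A) ⊔ [T]`, and any character of `B` restricting to `χA ∘ f⁻¹`
  -- and to the ∞-type is continuous (proper ⊔ compact).
  have hBeq : (f.range ⊔ (infUnitsToClass K).range : Subgroup (IdeleClassGroup K)) =
      f.range ⊔ (torusToClass K).range := by
    apply le_antisymm
    · exact sup_le le_sup_left hpolar
    · refine sup_le le_sup_left ?_
      rintro _ ⟨t, rfl⟩
      exact Subgroup.mem_sup_right ⟨(t : (InfiniteAdeleRing K)ˣ), rfl⟩
  have hcont : ∀ χ : (f.range ⊔ (infUnitsToClass K).range : Subgroup (IdeleClassGroup K)) →* Circle,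
      (∀ (x : IdeleClassGroup K) (hx : x ∈ f.range),
        χ ⟨x, Subgroup.mem_sup_left hx⟩ = χ₁ ⟨x, hx⟩) →
      (∀ u : (InfiniteAdeleRing K)ˣ,
        χ ⟨infUnitsToClass K u, Subgroup.mem_sup_right ⟨u, rfl⟩⟩ = infinityTypeChar K e u) →
      Continuous χ := by
    intro χ h1 h2
    -- transport to the subgroup `f(A) ⊔ [T]`
    let ι : (f.range ⊔ (torusToClass K).range : Subgroup (IdeleClassGroup K)) →*
        (f.range ⊔ (infUnitsToClass K).range : Subgroup (IdeleClassGroup K)) :=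
      Subgroup.inclusion hBeq.ge
    have hχι : Continuous (χ.comp ι) := by
      rw [continuous_char_range_sup_torus_iff K f hf]
      constructor
      · have hfun : (fun a : A => (χ.comp ι) ⟨f a, Subgroup.mem_sup_left ⟨a, rfl⟩⟩) = χA := by
          funext a
          show χ ⟨f a, _⟩ = χA a
          rw [h1 (f a) ⟨a, rfl⟩, hχ₁]
        rw [hfun]
        exact hχA
      · have hfun : (fun t : normOneTorus K =>
            (χ.comp ι) ⟨torusToClass K t, Subgroup.mem_sup_right ⟨t, rfl⟩⟩) =
            fun t : normOneTorus K => infinityTypeChar K e (↑t : (InfiniteAdeleRing K)ˣ) := by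
          funext t
          exact h2 (t : (InfiniteAdeleRing K)ˣ)
        rw [hfun]
        exact (continuous_infinityTypeChar K e).comp continuous_subtype_val
    have hback : Continuous (Subgroup.inclusion hBeq.le :
        (f.range ⊔ (infUnitsToClass K).range : Subgroup (IdeleClassGroup K)) →
        (f.range ⊔ (torusToClass K).range : Subgroup (IdeleClassGroup K))) :=
      Continuous.subtype_mk continuous_subtype_val _
    have hfac : (χ : _ → Circle) = (χ.comp ι) ∘ Subgroup.inclusion hBeq.le := by
      funext x
      rfl
    rw [hfac]
    exact hχι.comp hback
  -- Step 4: glue and extend.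
  obtain ⟨ψ, hψe, hψ⟩ := exists_ideleClassChar_of_compatible K f.range χ₁ e hcompat' hcont
  exact ⟨ψ, hψe, fun a => by rw [hψ (f a) ⟨a, rfl⟩, hχ₁]⟩

/-- **Unitary idele class characters with prescribed pull-back and ∞-type**, polar hypothesis in the
form `hpos`: the positive-real idele classes lie in `f(A)`. [cite: WeilBNT1967, Ch. VII §3] -/
theorem exists_ideleClassChar_of_isProperMap' {A : Type*} [Group A] [TopologicalSpace A]
    (f : A →* IdeleClassGroup K) (hf : IsProperMap f)
    (χA : A →* Circle) (hχA : Continuous χA) (hker : ∀ a, f a = 1 → χA a = 1)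
    (e : InfinitePlace K → ℤ)
    (hcompat : ∀ (a : A) (u : (InfiniteAdeleRing K)ˣ),
      f a = infUnitsToClass K u → χA a = infinityTypeChar K e u)
    (hpos : (posRealToClass K).range ≤ f.range) :
    ∃ ψ : IdeleClassGroup K →ₜ* Circle,
      HasInfinityType K ψ e ∧ ∀ a : A, ψ (f a) = χA a :=
  exists_ideleClassChar_of_isProperMap K f hf χA hχA hker e hcompat
    (hpolar_of_posRealUnits_le K f hpos)

end Literature.NumberTheory.Automorphic.IdeleClassGroup

end
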